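import Mathlib.Algebra.BigOperators.Group.Finset.Sigma
import Mathlib.Tactic.NormNum
import Mathlib.Tactic.IntervalCases
import Mathlib.Tactic.Positivity
import Mathlib.Tactic.Ring
import Summits.CriticalPhenomena.PercolationContinuityZ3.Theorems.PercNearOneGluingNoHeavyLowerTailAntiBandBlockSum

/-!
# `NoHeavyLowerTail` (crux stmt-CriticalPhenomena-4575), lane prim-ineq-gen-4 (gen 27): type-free Gram identity and PSD of `Q_ball` at `(n,k) = (6,2)`

Support file (`--supports stmt-CriticalPhenomena-4575`; memo `run/shared/lean/prim/prim-ineq-gen-4/FINDING-OFFDIAG-UNIVERSAL-g27.md` §7(d), step (ii) for k = 2).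
No definitions, no `sorry`, standard axioms.  Uses `AntiBandBlockCount.sum_powersetCard_card_inter_eq_sum_blocks` (file `…AntiBandBlockSum.lean`).

-/
/-!
## Third part (gen 27): the type-free Gram identity and positive semidefiniteness of `Q_ball` at `(n,k) = (6,2)`

`Q[a,b] := C(6 − #(a∪b), 3) − [a ⊆ b] − [b ⊆ a]` (`= C(6−#(a∪b), 3−#(a∪b))` for `#(a∪b) ≤ 3`, `0` beyond) on the ball `{a ⊆ β : #a ≤ 2}`, `|β| = 6` (the universal kernel of g26 THEOREM A at `k = 2`).  With the
rational tables of `tools-g27/certs/gramcert_k2.json`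
`Q[a,b] = 9/10·Σ_w G₁(#a)G₁(#b) + 3/10·Σ_w G₂(#a)G₂(#b) + 2/3·Σ_w G₃(#a,#(w∩a))G₃(#b,#(w∩b))`  (`w` over the 3-subsets of `β`; `gram_identity_k2`), hence
`Σ_{a,b} x_a x_b Q[a,b] ≥ 0` for every `x` (`qform_ball_nonneg_k2`) — the PSD input that makes THEOREM A at `k = 2` ((AB_3)(6)) a finite identity (memo §7(d), step (ii)).
-/

namespace Summit.CriticalPhenomena.PercolationContinuityZ3.Theorems.AntiBandBlockCount

open Finset

variable {β : Type*} [DecidableEq β]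

/-- `a ⊆ b ↔ #(a ∩ b) = #a`. [elementary] -/
theorem subset_iff_card_inter_eq (a b : Finset β) : a ⊆ b ↔ #(a ∩ b) = #a := by
  constructor
  · intro h; rw [inter_eq_left.mpr h]
  · intro h
    have : a ∩ b = a := Finset.eq_of_subset_of_card_le inter_subset_left (by rw [h])
    rw [← this]; exact inter_subset_right

/-- Rearrangement: `Σ_a Σ_b x_a x_b (Σ_w G(a,w) G(b,w)) = Σ_w (Σ_a G(a,w) x_a)²`. [elementary] -/
theorem sum_sum_mul_gram_eq_sum_sq {α γ : Type*} (s : Finset α) (t : Finset γ) (x : α → ℚ) (G : α → γ → ℚ) :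
    ∑ a ∈ s, ∑ b ∈ s, x a * x b * ∑ w ∈ t, G a w * G b w = ∑ w ∈ t, (∑ a ∈ s, G a w * x a) ^ 2 := by
  have h1 : ∀ w ∈ t, (∑ a ∈ s, G a w * x a) ^ 2 = ∑ a ∈ s, ∑ b ∈ s, x a * x b * (G a w * G b w) := by
    intro w _
    rw [sq, Finset.sum_mul_sum]
    apply Finset.sum_congr rfl; intro a _
    apply Finset.sum_congr rfl; intro b _
    ring
  calc ∑ a ∈ s, ∑ b ∈ s, x a * x b * ∑ w ∈ t, G a w * G b w
      = ∑ a ∈ s, ∑ b ∈ s, ∑ w ∈ t, x a * x b * (G a w * G b w) := by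
        apply Finset.sum_congr rfl; intro a _
        apply Finset.sum_congr rfl; intro b _
        rw [Finset.mul_sum]
    _ = ∑ a ∈ s, ∑ w ∈ t, ∑ b ∈ s, x a * x b * (G a w * G b w) := by
        apply Finset.sum_congr rfl; intro a _
        exact Finset.sum_comm
    _ = ∑ w ∈ t, ∑ a ∈ s, ∑ b ∈ s, x a * x b * (G a w * G b w) := Finset.sum_comm
    _ = ∑ w ∈ t, (∑ a ∈ s, G a w * x a) ^ 2 := by
        apply Finset.sum_congr rfl; intro w hw
        rw [h1 w hw]

/-- Numerics of the class `(#a,#b,#(a∩b)) = (0,0,0)` of `gram_identity_k2`. [gen 27] -/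
theorem gram_k2_num_000 :
    (9/10 * ((20:ℚ) * ((fun i : ℕ => (if i = 0 then (1:ℚ) else if i = 1 then 1/2 else 1/6)) 0 * (fun i : ℕ => (if i = 0 then (1:ℚ) else if i = 1 then 1/2 else 1/6)) 0)) + 3/10 * ((20:ℚ) * ((fun i : ℕ => (if i = 0 then (0:ℚ) else 1/6)) 0 * (fun i : ℕ => (if i = 0 then (0:ℚ) else 1/6)) 0))
        + 2/3 * ∑ p ∈ ((range (3 + 1) ×ˢ range (3 + 1)) ×ˢ (range (3 + 1) ×ˢ range (3 + 1))).filter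
            (fun p => p.1.1 + p.1.2 + p.2.1 + p.2.2 = 3),
          (((0).choose p.1.1 * (0 - 0).choose p.1.2 * (0 - 0).choose p.2.1 * (6 - (0 + 0 - 0)).choose p.2.2 : ℕ) : ℚ)
            * ((fun i m : ℕ => (if i = 0 then (0:ℚ) else if i = 1 then (if m = 0 then -1/2 else 1/2) else (if m = 0 then -1/2 else if m = 1 then 0 else 1/2))) 0 (p.1.1 + p.1.2) * (fun i m : ℕ => (if i = 0 then (0:ℚ) else if i = 1 then (if m = 0 then -1/2 else 1/2) else (if m = 0 then -1/2 else if m = 1 then 0 else 1/2))) 0 (p.1.1 + p.2.1)))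
      = ((((6 - (0 + 0 - 0)).choose 3 : ℕ) : ℚ) - (if 0 = 0 then 1 else 0) - (if 0 = 0 then 1 else 0)) := by
  simp only [Finset.sum_filter, Finset.sum_product, Finset.sum_range_succ, Finset.sum_range_zero]
  norm_num [Nat.choose]
/-- Numerics of the class `(#a,#b,#(a∩b)) = (0,1,0)` of `gram_identity_k2`. [gen 27] -/
theorem gram_k2_num_010 :
    (9/10 * ((20:ℚ) * ((fun i : ℕ => (if i = 0 then (1:ℚ) else if i = 1 then 1/2 else 1/6)) 0 * (fun i : ℕ => (if i = 0 then (1:ℚ) else if i = 1 then 1/2 else 1/6)) 1)) + 3/10 * ((20:ℚ) * ((fun i : ℕ => (if i = 0 then (0:ℚ) else 1/6)) 0 * (fun i : ℕ => (if i = 0 then (0:ℚ) else 1/6)) 1))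
        + 2/3 * ∑ p ∈ ((range (3 + 1) ×ˢ range (3 + 1)) ×ˢ (range (3 + 1) ×ˢ range (3 + 1))).filter
            (fun p => p.1.1 + p.1.2 + p.2.1 + p.2.2 = 3),
          (((0).choose p.1.1 * (0 - 0).choose p.1.2 * (1 - 0).choose p.2.1 * (6 - (0 + 1 - 0)).choose p.2.2 : ℕ) : ℚ)
            * ((fun i m : ℕ => (if i = 0 then (0:ℚ) else if i = 1 then (if m = 0 then -1/2 else 1/2) else (if m = 0 then -1/2 else if m = 1 then 0 else 1/2))) 0 (p.1.1 + p.1.2) * (fun i m : ℕ => (if i = 0 then (0:ℚ) else if i = 1 then (if m = 0 then -1/2 else 1/2) else (if m = 0 then -1/2 else if m = 1 then 0 else 1/2))) 1 (p.1.1 + p.2.1)))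
      = ((((6 - (0 + 1 - 0)).choose 3 : ℕ) : ℚ) - (if 0 = 0 then 1 else 0) - (if 0 = 1 then 1 else 0)) := by
  simp only [Finset.sum_filter, Finset.sum_product, Finset.sum_range_succ, Finset.sum_range_zero]
  norm_num [Nat.choose]
/-- Numerics of the class `(#a,#b,#(a∩b)) = (0,2,0)` of `gram_identity_k2`. [gen 27] -/
theorem gram_k2_num_020 :
    (9/10 * ((20:ℚ) * ((fun i : ℕ => (if i = 0 then (1:ℚ) else if i = 1 then 1/2 else 1/6)) 0 * (fun i : ℕ => (if i = 0 then (1:ℚ) else if i = 1 then 1/2 else 1/6)) 2)) + 3/10 * ((20:ℚ) * ((fun i : ℕ => (if i = 0 then (0:ℚ) else 1/6)) 0 * (fun i : ℕ => (if i = 0 then (0:ℚ) else 1/6)) 2))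
        + 2/3 * ∑ p ∈ ((range (3 + 1) ×ˢ range (3 + 1)) ×ˢ (range (3 + 1) ×ˢ range (3 + 1))).filter
            (fun p => p.1.1 + p.1.2 + p.2.1 + p.2.2 = 3),
          (((0).choose p.1.1 * (0 - 0).choose p.1.2 * (2 - 0).choose p.2.1 * (6 - (0 + 2 - 0)).choose p.2.2 : ℕ) : ℚ)
            * ((fun i m : ℕ => (if i = 0 then (0:ℚ) else if i = 1 then (if m = 0 then -1/2 else 1/2) else (if m = 0 then -1/2 else if m = 1 then 0 else 1/2))) 0 (p.1.1 + p.1.2) * (fun i m : ℕ => (if i = 0 then (0:ℚ) else if i = 1 then (if m = 0 then -1/2 else 1/2) else (if m = 0 then -1/2 else if m = 1 then 0 else 1/2))) 2 (p.1.1 + p.2.1)))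
      = ((((6 - (0 + 2 - 0)).choose 3 : ℕ) : ℚ) - (if 0 = 0 then 1 else 0) - (if 0 = 2 then 1 else 0)) := by
  simp only [Finset.sum_filter, Finset.sum_product, Finset.sum_range_succ, Finset.sum_range_zero]
  norm_num [Nat.choose]
/-- Numerics of the class `(#a,#b,#(a∩b)) = (1,0,0)` of `gram_identity_k2`. [gen 27] -/
theorem gram_k2_num_100 :
    (9/10 * ((20:ℚ) * ((fun i : ℕ => (if i = 0 then (1:ℚ) else if i = 1 then 1/2 else 1/6)) 1 * (fun i : ℕ => (if i = 0 then (1:ℚ) else if i = 1 then 1/2 else 1/6)) 0)) + 3/10 * ((20:ℚ) * ((fun i : ℕ => (if i = 0 then (0:ℚ) else 1/6)) 1 * (fun i : ℕ => (if i = 0 then (0:ℚ) else 1/6)) 0))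
        + 2/3 * ∑ p ∈ ((range (3 + 1) ×ˢ range (3 + 1)) ×ˢ (range (3 + 1) ×ˢ range (3 + 1))).filter
            (fun p => p.1.1 + p.1.2 + p.2.1 + p.2.2 = 3),
          (((0).choose p.1.1 * (1 - 0).choose p.1.2 * (0 - 0).choose p.2.1 * (6 - (1 + 0 - 0)).choose p.2.2 : ℕ) : ℚ)
            * ((fun i m : ℕ => (if i = 0 then (0:ℚ) else if i = 1 then (if m = 0 then -1/2 else 1/2) else (if m = 0 then -1/2 else if m = 1 then 0 else 1/2))) 1 (p.1.1 + p.1.2) * (fun i m : ℕ => (if i = 0 then (0:ℚ) else if i = 1 then (if m = 0 then -1/2 else 1/2) else (if m = 0 then -1/2 else if m = 1 then 0 else 1/2))) 0 (p.1.1 + p.2.1)))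
      = ((((6 - (1 + 0 - 0)).choose 3 : ℕ) : ℚ) - (if 0 = 1 then 1 else 0) - (if 0 = 0 then 1 else 0)) := by
  simp only [Finset.sum_filter, Finset.sum_product, Finset.sum_range_succ, Finset.sum_range_zero]
  norm_num [Nat.choose]
/-- Numerics of the class `(#a,#b,#(a∩b)) = (1,1,0)` of `gram_identity_k2`. [gen 27] -/
theorem gram_k2_num_110 :
    (9/10 * ((20:ℚ) * ((fun i : ℕ => (if i = 0 then (1:ℚ) else if i = 1 then 1/2 else 1/6)) 1 * (fun i : ℕ => (if i = 0 then (1:ℚ) else if i = 1 then 1/2 else 1/6)) 1)) + 3/10 * ((20:ℚ) * ((fun i : ℕ => (if i = 0 then (0:ℚ) else 1/6)) 1 * (fun i : ℕ => (if i = 0 then (0:ℚ) else 1/6)) 1))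
        + 2/3 * ∑ p ∈ ((range (3 + 1) ×ˢ range (3 + 1)) ×ˢ (range (3 + 1) ×ˢ range (3 + 1))).filter
            (fun p => p.1.1 + p.1.2 + p.2.1 + p.2.2 = 3),
          (((0).choose p.1.1 * (1 - 0).choose p.1.2 * (1 - 0).choose p.2.1 * (6 - (1 + 1 - 0)).choose p.2.2 : ℕ) : ℚ)
            * ((fun i m : ℕ => (if i = 0 then (0:ℚ) else if i = 1 then (if m = 0 then -1/2 else 1/2) else (if m = 0 then -1/2 else if m = 1 then 0 else 1/2))) 1 (p.1.1 + p.1.2) * (fun i m : ℕ => (if i = 0 then (0:ℚ) else if i = 1 then (if m = 0 then -1/2 else 1/2) else (if m = 0 then -1/2 else if m = 1 then 0 else 1/2))) 1 (p.1.1 + p.2.1)))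
      = ((((6 - (1 + 1 - 0)).choose 3 : ℕ) : ℚ) - (if 0 = 1 then 1 else 0) - (if 0 = 1 then 1 else 0)) := by
  simp only [Finset.sum_filter, Finset.sum_product, Finset.sum_range_succ, Finset.sum_range_zero]
  norm_num [Nat.choose]
/-- Numerics of the class `(#a,#b,#(a∩b)) = (1,1,1)` of `gram_identity_k2`. [gen 27] -/
theorem gram_k2_num_111 :
    (9/10 * ((20:ℚ) * ((fun i : ℕ => (if i = 0 then (1:ℚ) else if i = 1 then 1/2 else 1/6)) 1 * (fun i : ℕ => (if i = 0 then (1:ℚ) else if i = 1 then 1/2 else 1/6)) 1)) + 3/10 * ((20:ℚ) * ((fun i : ℕ => (if i = 0 then (0:ℚ) else 1/6)) 1 * (fun i : ℕ => (if i = 0 then (0:ℚ) else 1/6)) 1))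
        + 2/3 * ∑ p ∈ ((range (3 + 1) ×ˢ range (3 + 1)) ×ˢ (range (3 + 1) ×ˢ range (3 + 1))).filter
            (fun p => p.1.1 + p.1.2 + p.2.1 + p.2.2 = 3),
          (((1).choose p.1.1 * (1 - 1).choose p.1.2 * (1 - 1).choose p.2.1 * (6 - (1 + 1 - 1)).choose p.2.2 : ℕ) : ℚ)
            * ((fun i m : ℕ => (if i = 0 then (0:ℚ) else if i = 1 then (if m = 0 then -1/2 else 1/2) else (if m = 0 then -1/2 else if m = 1 then 0 else 1/2))) 1 (p.1.1 + p.1.2) * (fun i m : ℕ => (if i = 0 then (0:ℚ) else if i = 1 then (if m = 0 then -1/2 else 1/2) else (if m = 0 then -1/2 else if m = 1 then 0 else 1/2))) 1 (p.1.1 + p.2.1)))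
      = ((((6 - (1 + 1 - 1)).choose 3 : ℕ) : ℚ) - (if 1 = 1 then 1 else 0) - (if 1 = 1 then 1 else 0)) := by
  simp only [Finset.sum_filter, Finset.sum_product, Finset.sum_range_succ, Finset.sum_range_zero]
  norm_num [Nat.choose]
/-- Numerics of the class `(#a,#b,#(a∩b)) = (1,2,0)` of `gram_identity_k2`. [gen 27] -/
theorem gram_k2_num_120 :
    (9/10 * ((20:ℚ) * ((fun i : ℕ => (if i = 0 then (1:ℚ) else if i = 1 then 1/2 else 1/6)) 1 * (fun i : ℕ => (if i = 0 then (1:ℚ) else if i = 1 then 1/2 else 1/6)) 2)) + 3/10 * ((20:ℚ) * ((fun i : ℕ => (if i = 0 then (0:ℚ) else 1/6)) 1 * (fun i : ℕ => (if i = 0 then (0:ℚ) else 1/6)) 2))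
        + 2/3 * ∑ p ∈ ((range (3 + 1) ×ˢ range (3 + 1)) ×ˢ (range (3 + 1) ×ˢ range (3 + 1))).filter
            (fun p => p.1.1 + p.1.2 + p.2.1 + p.2.2 = 3),
          (((0).choose p.1.1 * (1 - 0).choose p.1.2 * (2 - 0).choose p.2.1 * (6 - (1 + 2 - 0)).choose p.2.2 : ℕ) : ℚ)
            * ((fun i m : ℕ => (if i = 0 then (0:ℚ) else if i = 1 then (if m = 0 then -1/2 else 1/2) else (if m = 0 then -1/2 else if m = 1 then 0 else 1/2))) 1 (p.1.1 + p.1.2) * (fun i m : ℕ => (if i = 0 then (0:ℚ) else if i = 1 then (if m = 0 then -1/2 else 1/2) else (if m = 0 then -1/2 else if m = 1 then 0 else 1/2))) 2 (p.1.1 + p.2.1)))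
      = ((((6 - (1 + 2 - 0)).choose 3 : ℕ) : ℚ) - (if 0 = 1 then 1 else 0) - (if 0 = 2 then 1 else 0)) := by
  simp only [Finset.sum_filter, Finset.sum_product, Finset.sum_range_succ, Finset.sum_range_zero]
  norm_num [Nat.choose]
/-- Numerics of the class `(#a,#b,#(a∩b)) = (1,2,1)` of `gram_identity_k2`. [gen 27] -/
theorem gram_k2_num_121 :
    (9/10 * ((20:ℚ) * ((fun i : ℕ => (if i = 0 then (1:ℚ) else if i = 1 then 1/2 else 1/6)) 1 * (fun i : ℕ => (if i = 0 then (1:ℚ) else if i = 1 then 1/2 else 1/6)) 2)) + 3/10 * ((20:ℚ) * ((fun i : ℕ => (if i = 0 then (0:ℚ) else 1/6)) 1 * (fun i : ℕ => (if i = 0 then (0:ℚ) else 1/6)) 2))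
        + 2/3 * ∑ p ∈ ((range (3 + 1) ×ˢ range (3 + 1)) ×ˢ (range (3 + 1) ×ˢ range (3 + 1))).filter
            (fun p => p.1.1 + p.1.2 + p.2.1 + p.2.2 = 3),
          (((1).choose p.1.1 * (1 - 1).choose p.1.2 * (2 - 1).choose p.2.1 * (6 - (1 + 2 - 1)).choose p.2.2 : ℕ) : ℚ)
            * ((fun i m : ℕ => (if i = 0 then (0:ℚ) else if i = 1 then (if m = 0 then -1/2 else 1/2) else (if m = 0 then -1/2 else if m = 1 then 0 else 1/2))) 1 (p.1.1 + p.1.2) * (fun i m : ℕ => (if i = 0 then (0:ℚ) else if i = 1 then (if m = 0 then -1/2 else 1/2) else (if m = 0 then -1/2 else if m = 1 then 0 else 1/2))) 2 (p.1.1 + p.2.1)))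
      = ((((6 - (1 + 2 - 1)).choose 3 : ℕ) : ℚ) - (if 1 = 1 then 1 else 0) - (if 1 = 2 then 1 else 0)) := by
  simp only [Finset.sum_filter, Finset.sum_product, Finset.sum_range_succ, Finset.sum_range_zero]
  norm_num [Nat.choose]
/-- Numerics of the class `(#a,#b,#(a∩b)) = (2,0,0)` of `gram_identity_k2`. [gen 27] -/
theorem gram_k2_num_200 :
    (9/10 * ((20:ℚ) * ((fun i : ℕ => (if i = 0 then (1:ℚ) else if i = 1 then 1/2 else 1/6)) 2 * (fun i : ℕ => (if i = 0 then (1:ℚ) else if i = 1 then 1/2 else 1/6)) 0)) + 3/10 * ((20:ℚ) * ((fun i : ℕ => (if i = 0 then (0:ℚ) else 1/6)) 2 * (fun i : ℕ => (if i = 0 then (0:ℚ) else 1/6)) 0))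
        + 2/3 * ∑ p ∈ ((range (3 + 1) ×ˢ range (3 + 1)) ×ˢ (range (3 + 1) ×ˢ range (3 + 1))).filter
            (fun p => p.1.1 + p.1.2 + p.2.1 + p.2.2 = 3),
          (((0).choose p.1.1 * (2 - 0).choose p.1.2 * (0 - 0).choose p.2.1 * (6 - (2 + 0 - 0)).choose p.2.2 : ℕ) : ℚ)
            * ((fun i m : ℕ => (if i = 0 then (0:ℚ) else if i = 1 then (if m = 0 then -1/2 else 1/2) else (if m = 0 then -1/2 else if m = 1 then 0 else 1/2))) 2 (p.1.1 + p.1.2) * (fun i m : ℕ => (if i = 0 then (0:ℚ) else if i = 1 then (if m = 0 then -1/2 else 1/2) else (if m = 0 then -1/2 else if m = 1 then 0 else 1/2))) 0 (p.1.1 + p.2.1)))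
      = ((((6 - (2 + 0 - 0)).choose 3 : ℕ) : ℚ) - (if 0 = 2 then 1 else 0) - (if 0 = 0 then 1 else 0)) := by
  simp only [Finset.sum_filter, Finset.sum_product, Finset.sum_range_succ, Finset.sum_range_zero]
  norm_num [Nat.choose]
/-- Numerics of the class `(#a,#b,#(a∩b)) = (2,1,0)` of `gram_identity_k2`. [gen 27] -/
theorem gram_k2_num_210 :
    (9/10 * ((20:ℚ) * ((fun i : ℕ => (if i = 0 then (1:ℚ) else if i = 1 then 1/2 else 1/6)) 2 * (fun i : ℕ => (if i = 0 then (1:ℚ) else if i = 1 then 1/2 else 1/6)) 1)) + 3/10 * ((20:ℚ) * ((fun i : ℕ => (if i = 0 then (0:ℚ) else 1/6)) 2 * (fun i : ℕ => (if i = 0 then (0:ℚ) else 1/6)) 1))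
        + 2/3 * ∑ p ∈ ((range (3 + 1) ×ˢ range (3 + 1)) ×ˢ (range (3 + 1) ×ˢ range (3 + 1))).filter
            (fun p => p.1.1 + p.1.2 + p.2.1 + p.2.2 = 3),
          (((0).choose p.1.1 * (2 - 0).choose p.1.2 * (1 - 0).choose p.2.1 * (6 - (2 + 1 - 0)).choose p.2.2 : ℕ) : ℚ)
            * ((fun i m : ℕ => (if i = 0 then (0:ℚ) else if i = 1 then (if m = 0 then -1/2 else 1/2) else (if m = 0 then -1/2 else if m = 1 then 0 else 1/2))) 2 (p.1.1 + p.1.2) * (fun i m : ℕ => (if i = 0 then (0:ℚ) else if i = 1 then (if m = 0 then -1/2 else 1/2) else (if m = 0 then -1/2 else if m = 1 then 0 else 1/2))) 1 (p.1.1 + p.2.1)))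
      = ((((6 - (2 + 1 - 0)).choose 3 : ℕ) : ℚ) - (if 0 = 2 then 1 else 0) - (if 0 = 1 then 1 else 0)) := by
  simp only [Finset.sum_filter, Finset.sum_product, Finset.sum_range_succ, Finset.sum_range_zero]
  norm_num [Nat.choose]
/-- Numerics of the class `(#a,#b,#(a∩b)) = (2,1,1)` of `gram_identity_k2`. [gen 27] -/
theorem gram_k2_num_211 :
    (9/10 * ((20:ℚ) * ((fun i : ℕ => (if i = 0 then (1:ℚ) else if i = 1 then 1/2 else 1/6)) 2 * (fun i : ℕ => (if i = 0 then (1:ℚ) else if i = 1 then 1/2 else 1/6)) 1)) + 3/10 * ((20:ℚ) * ((fun i : ℕ => (if i = 0 then (0:ℚ) else 1/6)) 2 * (fun i : ℕ => (if i = 0 then (0:ℚ) else 1/6)) 1))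
        + 2/3 * ∑ p ∈ ((range (3 + 1) ×ˢ range (3 + 1)) ×ˢ (range (3 + 1) ×ˢ range (3 + 1))).filter
            (fun p => p.1.1 + p.1.2 + p.2.1 + p.2.2 = 3),
          (((1).choose p.1.1 * (2 - 1).choose p.1.2 * (1 - 1).choose p.2.1 * (6 - (2 + 1 - 1)).choose p.2.2 : ℕ) : ℚ)
            * ((fun i m : ℕ => (if i = 0 then (0:ℚ) else if i = 1 then (if m = 0 then -1/2 else 1/2) else (if m = 0 then -1/2 else if m = 1 then 0 else 1/2))) 2 (p.1.1 + p.1.2) * (fun i m : ℕ => (if i = 0 then (0:ℚ) else if i = 1 then (if m = 0 then -1/2 else 1/2) else (if m = 0 then -1/2 else if m = 1 then 0 else 1/2))) 1 (p.1.1 + p.2.1)))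
      = ((((6 - (2 + 1 - 1)).choose 3 : ℕ) : ℚ) - (if 1 = 2 then 1 else 0) - (if 1 = 1 then 1 else 0)) := by
  simp only [Finset.sum_filter, Finset.sum_product, Finset.sum_range_succ, Finset.sum_range_zero]
  norm_num [Nat.choose]
/-- Numerics of the class `(#a,#b,#(a∩b)) = (2,2,0)` of `gram_identity_k2`. [gen 27] -/
theorem gram_k2_num_220 :
    (9/10 * ((20:ℚ) * ((fun i : ℕ => (if i = 0 then (1:ℚ) else if i = 1 then 1/2 else 1/6)) 2 * (fun i : ℕ => (if i = 0 then (1:ℚ) else if i = 1 then 1/2 else 1/6)) 2)) + 3/10 * ((20:ℚ) * ((fun i : ℕ => (if i = 0 then (0:ℚ) else 1/6)) 2 * (fun i : ℕ => (if i = 0 then (0:ℚ) else 1/6)) 2))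
        + 2/3 * ∑ p ∈ ((range (3 + 1) ×ˢ range (3 + 1)) ×ˢ (range (3 + 1) ×ˢ range (3 + 1))).filter
            (fun p => p.1.1 + p.1.2 + p.2.1 + p.2.2 = 3),
          (((0).choose p.1.1 * (2 - 0).choose p.1.2 * (2 - 0).choose p.2.1 * (6 - (2 + 2 - 0)).choose p.2.2 : ℕ) : ℚ)
            * ((fun i m : ℕ => (if i = 0 then (0:ℚ) else if i = 1 then (if m = 0 then -1/2 else 1/2) else (if m = 0 then -1/2 else if m = 1 then 0 else 1/2))) 2 (p.1.1 + p.1.2) * (fun i m : ℕ => (if i = 0 then (0:ℚ) else if i = 1 then (if m = 0 then -1/2 else 1/2) else (if m = 0 then -1/2 else if m = 1 then 0 else 1/2))) 2 (p.1.1 + p.2.1)))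
      = ((((6 - (2 + 2 - 0)).choose 3 : ℕ) : ℚ) - (if 0 = 2 then 1 else 0) - (if 0 = 2 then 1 else 0)) := by
  simp only [Finset.sum_filter, Finset.sum_product, Finset.sum_range_succ, Finset.sum_range_zero]
  norm_num [Nat.choose]
/-- Numerics of the class `(#a,#b,#(a∩b)) = (2,2,1)` of `gram_identity_k2`. [gen 27] -/
theorem gram_k2_num_221 :
    (9/10 * ((20:ℚ) * ((fun i : ℕ => (if i = 0 then (1:ℚ) else if i = 1 then 1/2 else 1/6)) 2 * (fun i : ℕ => (if i = 0 then (1:ℚ) else if i = 1 then 1/2 else 1/6)) 2)) + 3/10 * ((20:ℚ) * ((fun i : ℕ => (if i = 0 then (0:ℚ) else 1/6)) 2 * (fun i : ℕ => (if i = 0 then (0:ℚ) else 1/6)) 2))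
        + 2/3 * ∑ p ∈ ((range (3 + 1) ×ˢ range (3 + 1)) ×ˢ (range (3 + 1) ×ˢ range (3 + 1))).filter
            (fun p => p.1.1 + p.1.2 + p.2.1 + p.2.2 = 3),
          (((1).choose p.1.1 * (2 - 1).choose p.1.2 * (2 - 1).choose p.2.1 * (6 - (2 + 2 - 1)).choose p.2.2 : ℕ) : ℚ)
            * ((fun i m : ℕ => (if i = 0 then (0:ℚ) else if i = 1 then (if m = 0 then -1/2 else 1/2) else (if m = 0 then -1/2 else if m = 1 then 0 else 1/2))) 2 (p.1.1 + p.1.2) * (fun i m : ℕ => (if i = 0 then (0:ℚ) else if i = 1 then (if m = 0 then -1/2 else 1/2) else (if m = 0 then -1/2 else if m = 1 then 0 else 1/2))) 2 (p.1.1 + p.2.1)))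
      = ((((6 - (2 + 2 - 1)).choose 3 : ℕ) : ℚ) - (if 1 = 2 then 1 else 0) - (if 1 = 2 then 1 else 0)) := by
  simp only [Finset.sum_filter, Finset.sum_product, Finset.sum_range_succ, Finset.sum_range_zero]
  norm_num [Nat.choose]
/-- Numerics of the class `(#a,#b,#(a∩b)) = (2,2,2)` of `gram_identity_k2`. [gen 27] -/
theorem gram_k2_num_222 :
    (9/10 * ((20:ℚ) * ((fun i : ℕ => (if i = 0 then (1:ℚ) else if i = 1 then 1/2 else 1/6)) 2 * (fun i : ℕ => (if i = 0 then (1:ℚ) else if i = 1 then 1/2 else 1/6)) 2)) + 3/10 * ((20:ℚ) * ((fun i : ℕ => (if i = 0 then (0:ℚ) else 1/6)) 2 * (fun i : ℕ => (if i = 0 then (0:ℚ) else 1/6)) 2))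
        + 2/3 * ∑ p ∈ ((range (3 + 1) ×ˢ range (3 + 1)) ×ˢ (range (3 + 1) ×ˢ range (3 + 1))).filter
            (fun p => p.1.1 + p.1.2 + p.2.1 + p.2.2 = 3),
          (((2).choose p.1.1 * (2 - 2).choose p.1.2 * (2 - 2).choose p.2.1 * (6 - (2 + 2 - 2)).choose p.2.2 : ℕ) : ℚ)
            * ((fun i m : ℕ => (if i = 0 then (0:ℚ) else if i = 1 then (if m = 0 then -1/2 else 1/2) else (if m = 0 then -1/2 else if m = 1 then 0 else 1/2))) 2 (p.1.1 + p.1.2) * (fun i m : ℕ => (if i = 0 then (0:ℚ) else if i = 1 then (if m = 0 then -1/2 else 1/2) else (if m = 0 then -1/2 else if m = 1 then 0 else 1/2))) 2 (p.1.1 + p.2.1)))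
      = ((((6 - (2 + 2 - 2)).choose 3 : ℕ) : ℚ) - (if 2 = 2 then 1 else 0) - (if 2 = 2 then 1 else 0)) := by
  simp only [Finset.sum_filter, Finset.sum_product, Finset.sum_range_succ, Finset.sum_range_zero]
  norm_num [Nat.choose]
/-- Reduction of both sides of the `(6,2)` Gram identity to the class data `(#a, #b, #(a ∩ b))` (block sum for the third Gram term). [gen 27] -/
theorem gram_k2_reduce [Fintype β] (hβ : Fintype.card β = 6) (a b : Finset β) :
    ((((6 - #(a ∪ b)).choose 3 : ℕ) : ℚ) - (if a ⊆ b then 1 else 0) - (if b ⊆ a then 1 else 0)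
      = 9/10 * ∑ _w ∈ (univ : Finset β).powersetCard 3, (fun i : ℕ => (if i = 0 then (1:ℚ) else if i = 1 then 1/2 else 1/6)) #a * (fun i : ℕ => (if i = 0 then (1:ℚ) else if i = 1 then 1/2 else 1/6)) #b
        + 3/10 * ∑ _w ∈ (univ : Finset β).powersetCard 3, (fun i : ℕ => (if i = 0 then (0:ℚ) else 1/6)) #a * (fun i : ℕ => (if i = 0 then (0:ℚ) else 1/6)) #b
        + 2/3 * ∑ w ∈ (univ : Finset β).powersetCard 3, (fun i m : ℕ => (if i = 0 then (0:ℚ) else if i = 1 then (if m = 0 then -1/2 else 1/2) else (if m = 0 then -1/2 else if m = 1 then 0 else 1/2))) #a #(w ∩ a) * (fun i m : ℕ => (if i = 0 then (0:ℚ) else if i = 1 then (if m = 0 then -1/2 else 1/2) else (if m = 0 then -1/2 else if m = 1 then 0 else 1/2))) #b #(w ∩ b))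
    ↔ (((((6 - (#a + #b - #(a ∩ b))).choose 3 : ℕ) : ℚ) - (if #(a ∩ b) = #a then 1 else 0) - (if #(a ∩ b) = #b then 1 else 0))
      = (9/10 * ((20:ℚ) * ((fun i : ℕ => (if i = 0 then (1:ℚ) else if i = 1 then 1/2 else 1/6)) #a * (fun i : ℕ => (if i = 0 then (1:ℚ) else if i = 1 then 1/2 else 1/6)) #b)) + 3/10 * ((20:ℚ) * ((fun i : ℕ => (if i = 0 then (0:ℚ) else 1/6)) #a * (fun i : ℕ => (if i = 0 then (0:ℚ) else 1/6)) #b))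
        + 2/3 * ∑ p ∈ ((range (3 + 1) ×ˢ range (3 + 1)) ×ˢ (range (3 + 1) ×ˢ range (3 + 1))).filter
            (fun p => p.1.1 + p.1.2 + p.2.1 + p.2.2 = 3),
          (((#(a ∩ b)).choose p.1.1 * (#a - #(a ∩ b)).choose p.1.2 * (#b - #(a ∩ b)).choose p.2.1 * (6 - (#a + #b - #(a ∩ b))).choose p.2.2 : ℕ) : ℚ)
            * ((fun i m : ℕ => (if i = 0 then (0:ℚ) else if i = 1 then (if m = 0 then -1/2 else 1/2) else (if m = 0 then -1/2 else if m = 1 then 0 else 1/2))) #a (p.1.1 + p.1.2) * (fun i m : ℕ => (if i = 0 then (0:ℚ) else if i = 1 then (if m = 0 then -1/2 else 1/2) else (if m = 0 then -1/2 else if m = 1 then 0 else 1/2))) #b (p.1.1 + p.2.1)))) := by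
  have hW : #((univ : Finset β).powersetCard 3) = 20 := by
    rw [Finset.card_powersetCard, Finset.card_univ, hβ]; rfl
  have hsub1 : (a ⊆ b) ↔ #(a ∩ b) = #a := subset_iff_card_inter_eq a b
  have hsub2 : (b ⊆ a) ↔ #(a ∩ b) = #b := by rw [inter_comm]; exact subset_iff_card_inter_eq b a
  have hab : #(a \ b) = #a - #(a ∩ b) := by
    have := Finset.card_sdiff_add_card_inter a b; omega
  have hba : #(b \ a) = #b - #(a ∩ b) := by
    have := Finset.card_sdiff_add_card_inter b a; rw [inter_comm] at this; omega
  have hunion : #(a ∪ b) = #a + #b - #(a ∩ b) := by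
    have := Finset.card_union_add_card_inter a b; omega
  have hcompl : #((a ∪ b)ᶜ) = 6 - (#a + #b - #(a ∩ b)) := by
    rw [Finset.card_compl, hβ, hunion]
  rw [Finset.sum_const, Finset.sum_const, hW, nsmul_eq_mul, nsmul_eq_mul,
      sum_powersetCard_card_inter_eq_sum_blocks a b 3 (fun s t => (fun i m : ℕ => (if i = 0 then (0:ℚ) else if i = 1 then (if m = 0 then -1/2 else 1/2) else (if m = 0 then -1/2 else if m = 1 then 0 else 1/2))) #a s * (fun i m : ℕ => (if i = 0 then (0:ℚ) else if i = 1 then (if m = 0 then -1/2 else 1/2) else (if m = 0 then -1/2 else if m = 1 then 0 else 1/2))) #b t),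
      hab, hba, hcompl, hunion]
  simp only [hsub1, hsub2, Nat.cast_ofNat]

/-- **Gram identity for `Q_ball` at `(6,2)`** (tools-g27/certs/gramcert_k2.json):  for `|β| = 6` and `#a, #b ≤ 2`,
`C(6−#(a∪b), 3) − [a⊆b] − [b⊆a] = 9/10·Σ_w G₁(#a)G₁(#b) + 3/10·Σ_w G₂(#a)G₂(#b) + 2/3·Σ_w G₃(#a,#(w∩a))·G₃(#b,#(w∩b))`, `w` over the `3`-subsets,
`G₁ = (1, 1/2, 1/6)`, `G₂ = (0, 1/6, 1/6)`, `G₃(1,·) = (−1/2, 1/2)`, `G₃(2,·) = (−1/2, 0, 1/2)`, `G₃(0,·) = 0`. [gen 27] -/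
theorem gram_identity_k2 [Fintype β] (hβ : Fintype.card β = 6) (a b : Finset β) (ha : #a ≤ 2) (hb : #b ≤ 2) :
    (((6 - #(a ∪ b)).choose 3 : ℕ) : ℚ) - (if a ⊆ b then 1 else 0) - (if b ⊆ a then 1 else 0)
      = 9/10 * ∑ _w ∈ (univ : Finset β).powersetCard 3, (fun i : ℕ => (if i = 0 then (1:ℚ) else if i = 1 then 1/2 else 1/6)) #a * (fun i : ℕ => (if i = 0 then (1:ℚ) else if i = 1 then 1/2 else 1/6)) #b
        + 3/10 * ∑ _w ∈ (univ : Finset β).powersetCard 3, (fun i : ℕ => (if i = 0 then (0:ℚ) else 1/6)) #a * (fun i : ℕ => (if i = 0 then (0:ℚ) else 1/6)) #b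
        + 2/3 * ∑ w ∈ (univ : Finset β).powersetCard 3, (fun i m : ℕ => (if i = 0 then (0:ℚ) else if i = 1 then (if m = 0 then -1/2 else 1/2) else (if m = 0 then -1/2 else if m = 1 then 0 else 1/2))) #a #(w ∩ a) * (fun i m : ℕ => (if i = 0 then (0:ℚ) else if i = 1 then (if m = 0 then -1/2 else 1/2) else (if m = 0 then -1/2 else if m = 1 then 0 else 1/2))) #b #(w ∩ b) := by
  rw [gram_k2_reduce hβ a b]
  have hu_a : #(a ∩ b) ≤ #a := card_le_card inter_subset_left
  have hu_b : #(a ∩ b) ≤ #b := card_le_card inter_subset_right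
  generalize hi : #a = i at *
  generalize hi' : #b = i' at *
  generalize hu : #(a ∩ b) = u at *
  have hi3 : i = 0 ∨ i = 1 ∨ i = 2 := by omega
  have hi3' : i' = 0 ∨ i' = 1 ∨ i' = 2 := by omega
  rcases hi3 with rfl | rfl | rfl <;> rcases hi3' with rfl | rfl | rfl
  · have hu0 : u = 0 := by omega
    subst hu0; exact (gram_k2_num_000).symm
  · have hu0 : u = 0 := by omega
    subst hu0; exact (gram_k2_num_010).symm
  · have hu0 : u = 0 := by omega
    subst hu0; exact (gram_k2_num_020).symm
  · have hu0 : u = 0 := by omega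
    subst hu0; exact (gram_k2_num_100).symm
  · have hu1 : u = 0 ∨ u = 1 := by omega
    rcases hu1 with rfl | rfl
    · exact (gram_k2_num_110).symm
    · exact (gram_k2_num_111).symm
  · have hu1 : u = 0 ∨ u = 1 := by omega
    rcases hu1 with rfl | rfl
    · exact (gram_k2_num_120).symm
    · exact (gram_k2_num_121).symm
  · have hu0 : u = 0 := by omega
    subst hu0; exact (gram_k2_num_200).symm
  · have hu1 : u = 0 ∨ u = 1 := by omega
    rcases hu1 with rfl | rfl
    · exact (gram_k2_num_210).symm
    · exact (gram_k2_num_211).symm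
  · have hu2 : u = 0 ∨ u = 1 ∨ u = 2 := by omega
    rcases hu2 with rfl | rfl | rfl
    · exact (gram_k2_num_220).symm
    · exact (gram_k2_num_221).symm
    · exact (gram_k2_num_222).symm

/-- **`Q_ball` is positive semidefinite at `(6,2)`.**  For `|β| = 6` and every `x : Finset β → ℚ`:
`0 ≤ Σ_{#a ≤ 2} Σ_{#b ≤ 2} x_a x_b (C(6−#(a∪b), 3) − [a⊆b] − [b⊆a])`.  (g26 THEOREM 5 for `k = 2`, by the type-free Gram identity `gram_identity_k2`.) [gen 27] -/
theorem qform_ball_nonneg_k2 [Fintype β] (hβ : Fintype.card β = 6) (x : Finset β → ℚ) :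
    0 ≤ ∑ a ∈ (univ : Finset β).powerset.filter (fun a => #a ≤ 2), ∑ b ∈ (univ : Finset β).powerset.filter (fun b => #b ≤ 2),
          x a * x b * ((((6 - #(a ∪ b)).choose 3 : ℕ) : ℚ) - (if a ⊆ b then 1 else 0) - (if b ⊆ a then 1 else 0)) := by
  set ball := (univ : Finset β).powerset.filter (fun a => #a ≤ 2) with hball
  set W := (univ : Finset β).powersetCard 3 with hW
  set G₁ : Finset β → Finset β → ℚ := fun a _w => (fun i : ℕ => (if i = 0 then (1:ℚ) else if i = 1 then 1/2 else 1/6)) #a with hG1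
  set G₂ : Finset β → Finset β → ℚ := fun a _w => (fun i : ℕ => (if i = 0 then (0:ℚ) else 1/6)) #a with hG2
  set G₃ : Finset β → Finset β → ℚ := fun a w =>
    (fun i m : ℕ => (if i = 0 then (0:ℚ) else if i = 1 then (if m = 0 then -1/2 else 1/2) else (if m = 0 then -1/2 else if m = 1 then 0 else 1/2))) #a #(w ∩ a) with hG3
  have hq : ∀ a ∈ ball, ∀ b ∈ ball,
      x a * x b * ((((6 - #(a ∪ b)).choose 3 : ℕ) : ℚ) - (if a ⊆ b then 1 else 0) - (if b ⊆ a then 1 else 0))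
        = 9/10 * (x a * x b * ∑ w ∈ W, G₁ a w * G₁ b w) + 3/10 * (x a * x b * ∑ w ∈ W, G₂ a w * G₂ b w)
          + 2/3 * (x a * x b * ∑ w ∈ W, G₃ a w * G₃ b w) := by
    intro a ha b hb
    rw [hball, mem_filter] at ha hb
    rw [gram_identity_k2 hβ a b ha.2 hb.2]
    simp only [hG1, hG2, hG3, hW]
    ring
  have hsum : ∑ a ∈ ball, ∑ b ∈ ball,
      x a * x b * ((((6 - #(a ∪ b)).choose 3 : ℕ) : ℚ) - (if a ⊆ b then 1 else 0) - (if b ⊆ a then 1 else 0))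
      = 9/10 * ∑ w ∈ W, (∑ a ∈ ball, G₁ a w * x a) ^ 2 + 3/10 * ∑ w ∈ W, (∑ a ∈ ball, G₂ a w * x a) ^ 2
        + 2/3 * ∑ w ∈ W, (∑ a ∈ ball, G₃ a w * x a) ^ 2 := by
    rw [← sum_sum_mul_gram_eq_sum_sq, ← sum_sum_mul_gram_eq_sum_sq, ← sum_sum_mul_gram_eq_sum_sq,
      Finset.mul_sum, Finset.mul_sum, Finset.mul_sum, ← Finset.sum_add_distrib, ← Finset.sum_add_distrib]
    apply Finset.sum_congr rfl
    intro a ha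
    rw [Finset.mul_sum, Finset.mul_sum, Finset.mul_sum, ← Finset.sum_add_distrib, ← Finset.sum_add_distrib]
    apply Finset.sum_congr rfl
    intro b hb
    exact hq a ha b hb
  rw [hsum]
  have h1 : 0 ≤ ∑ w ∈ W, (∑ a ∈ ball, G₁ a w * x a) ^ 2 := Finset.sum_nonneg (fun w _ => sq_nonneg _)
  have h2 : 0 ≤ ∑ w ∈ W, (∑ a ∈ ball, G₂ a w * x a) ^ 2 := Finset.sum_nonneg (fun w _ => sq_nonneg _)
  have h3 : 0 ≤ ∑ w ∈ W, (∑ a ∈ ball, G₃ a w * x a) ^ 2 := Finset.sum_nonneg (fun w _ => sq_nonneg _)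
  positivity

end Summit.CriticalPhenomena.PercolationContinuityZ3.Theorems.AntiBandBlockCount
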